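import Summits.CriticalPhenomena.PercolationContinuityZ3.Theorems.PercNearOneGluingNoHeavyPcintBSMXZ4Cert
import Summits.CriticalPhenomena.PercolationContinuityZ3.Theorems.PercNearOneGluingNoHeavyPcintBSMXTwoSq2
import HarnessLib

/-!
# PCINT lane, PHASE 6 (block renewal with reach-two pieces): kernel check of the meeting-probability coefficients for `ℤ^4`

Cell `prim-pcint`, seat `prim-pcint-1` (gen 15); memo `run/shared/lean/prim/pcint/T-FIBRE-ROUTE.md` §PHASE 6.
Instance `d = 4 = 2 + 2` (two time axes, the transverse plane), five-point law `(A₀, A₁, A₂)/DA = (60, 15, 5)/100`,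
horizon `N = 1000` in 40 chunks of 25 terms (checkpoint rows every 50 steps, window half-width `150`), cell `p = 2645/10^4`. exact rationals from `OSM.vrow 2 M` for
`i < 150` and the one-pass square check `DU² ≤ U_i² (3i+1)` (`u₂(i)² ≤ 1/(3i+1)`, `BSMX.sqAll`) beyond; `cadj ≤ u` beyond the cut.
-/

namespace Summit.CriticalPhenomena.PercolationContinuityZ3.Theorems.Pcint.BSMX.Z4

open Summit.CriticalPhenomena.PercolationContinuityZ3.Theorems.Pcint.BSMX Summit.CriticalPhenomena.PercolationContinuityZ3.Theorems.Pcint.BSM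

set_option maxHeartbeats 0 in
set_option maxRecDepth 65536 in
/-- `u 2 i · DU ≤ U_i` for `i < 150` (exact). -/
theorem hU1 : ∀ i ∈ List.range 150, uqv (OSM.vrow 2 150) 2 i * 1000000000000 ≤ (Ul.getD i 0 : ℚ) := by
  decide +kernel

set_option maxHeartbeats 0 in
set_option maxRecDepth 65536 in
/-- `DU² ≤ U_i² (3i+1)` for `i ≥ 150` (one pass). -/
theorem hU2 : sqAll 1000000000000 150 0 Ul = true := by
  decide +kernel

set_option maxHeartbeats 0 in
set_option maxRecDepth 65536 in
/-- `cadj 2 i · DU ≤ C_i` for `i < 150` (exact). -/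
theorem hC1 : ∀ i ∈ List.range 150, cadjqv (OSM.vrow 2 (150 + 1)) 2 i * 1000000000000 ≤ (Cl.getD i 0 : ℚ) := by
  decide +kernel

set_option maxHeartbeats 0 in
set_option maxRecDepth 65536 in
/-- `DU² ≤ C_i² (3i+1)` for `i ≥ 150` (one pass). -/
theorem hC2 : sqAll 1000000000000 150 0 Cl = true := by
  decide +kernel

set_option maxHeartbeats 0 in
set_option maxRecDepth 65536 in
/-- `u 2 i · DU ≤ U_i` for `i < 1000`. -/
theorem hUr : ∀ i < 1000, OSM.u 2 i * 1000000000000 ≤ (Ul.getD i 0 : ℝ) := u_two_flat (by decide +kernel) hU1 hU2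

set_option maxHeartbeats 0 in
set_option maxRecDepth 65536 in
/-- `cadj 2 i · DU ≤ C_i` for `i < 1000`. -/
theorem hCr : ∀ i < 1000, cadj 2 i * 1000000000000 ≤ (Cl.getD i 0 : ℝ) := cadj_two_flat (by decide +kernel) hC1 hC2

end Summit.CriticalPhenomena.PercolationContinuityZ3.Theorems.Pcint.BSMX.Z4
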